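import Mathlib
import Summits.NavierStokesRegularity.NavierStokesRegularity.Theorems.EulerZoomLiouvillePowerGaugeEulerLiouvilleHoopCapCostTools
import Summits.NavierStokesRegularity.NavierStokesRegularity.Theorems.EulerZoomLiouvillePowerGaugeEulerLiouvilleHoopAxisEndTerm
import HarnessLib

/-!
# Hoop core — t54-CC: the CAP COST BOUND (`NsregP2.R51.CapCostBound`, text verbatim)

Sub-problem `NavierStokesRegularity`, crux `PowerGaugeEulerLiouville` (a crux CLASS of self-similar Euler/NS strata on the MODEL lattice —
not NS regularity, not E).  Seat ns-ezl-w3 g7, tag t54-CC (nsreg-p2 g41 ROUND-51 «THE CAPS COME FOR FREE» §2, `r51/Sketch51.lean`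
3a26356e4f98d965; text of `NsregP2.R51.CapCostBound` VERBATIM over the tree's `HoopCore.discEnergy` / `HoopCore.discMass`
(`…HoopRunFreeDefs`, LEAD g15)).  Class-free, `C¹`.

`capCostBound` — with `w` a bound for the speed on the WALL CIRCLE at height `σ` (`‖V(axisPt σ T₀ θ)‖ ≤ w`) and `D = discEnergy V σ T₀`,
ALL FOUR end-disc functionals of the net axis law are bounded by `w`, `D`, `T₀`, `|γ||σ − c₂|` and `cylRadius c` alone — no value of
`V` inside the disc enters:
`endFlux ≤ 4πT₀w² + 2T₀D`, `|endTermC| ≤ T₀·√(2(|γ||σ−c₂| + w)² + D/π)·√(2w² + D/π)`, `|offsetTerm| ≤ |γ|·cylRadius c·T₀·√(2w² + D/π)`,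
`|discMass(σ,T₀)| ≤ (T₀²/√3)·√(2w² + D/π)`, `|discMass(σ,t)| ≤ t√t·√(T₀/3)·√(2w² + D/π)` (`0 < t ≤ T₀`).
Proof: the cap Hardy bounds `endFluxHardy` / `axialRayHardy` / `radialRayHardy` (`…HoopCapHardy`), the wall circle, and Cauchy–Schwarz on
`[0,T₀] × circle` (`…HoopCapCostTools`) applied to the chart forms `endTermC_eq_chart` / `offsetTerm_eq_chart` (`…HoopAxisEndTerm`) /
`discMass_eq_chart`.
WHAT THIS IS NOT: not NS, not E — class-free calculus on discs; 19832 OPEN; NS regularity NOT proved.  [nsreg-p2 g41 ROUND-51 §2; folklore]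
-/

noncomputable section

open MeasureTheory Set Metric Real Function WithLp intervalIntegral
open scoped InnerProductSpace RealInnerProductSpace Interval

set_option linter.dupNamespace false

namespace Summit.NavierStokesRegularity.NavierStokesRegularity.Theorems.PowerGaugeEulerLiouville.HoopCore

open Literature.Analysis Literature.Analysis.FluidPDE

/-- **THE CAP COST BOUND** (`NsregP2.R51.CapCostBound`, text verbatim): with `w` a bound for the speed on the WALL CIRCLE at height `σ`
and `D = discEnergy V σ T₀`, all four end-disc functionals of the net axis law (`endFlux`, `endTermC`, `offsetTerm`, `discMass`) are
bounded by `w`, `D`, `T₀`, `|γ||σ − c₂|` and `cylRadius c` alone — no value of `V` inside the disc enters.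
[nsreg-p2 g41 ROUND-51 §2; folklore (Hardy + Cauchy–Schwarz)] -/
theorem capCostBound :
    ∀ (γ : ℝ) (c : EuclideanSpace ℝ (Fin 3)) (V : EuclideanSpace ℝ (Fin 3) → EuclideanSpace ℝ (Fin 3)) (σ T₀ w : ℝ),
      0 < T₀ → 0 ≤ w → ContDiff ℝ 1 V →
      (∀ θ : ℝ, ‖V (axisPt σ T₀ θ)‖ ≤ w) →
        endFlux V σ T₀ ≤ 4 * Real.pi * T₀ * w ^ 2 + 2 * T₀ * discEnergy V σ T₀ ∧
        |endTermC γ c V T₀ σ|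
            ≤ T₀ * Real.sqrt (2 * (|γ| * |σ - c 2| + w) ^ 2 + discEnergy V σ T₀ / Real.pi)
                * Real.sqrt (2 * w ^ 2 + discEnergy V σ T₀ / Real.pi) ∧
        |offsetTerm γ c V T₀ σ|
            ≤ |γ| * cylRadius c * T₀ * Real.sqrt (2 * w ^ 2 + discEnergy V σ T₀ / Real.pi) ∧
        |discMass V σ T₀| ≤ T₀ ^ 2 / Real.sqrt 3 * Real.sqrt (2 * w ^ 2 + discEnergy V σ T₀ / Real.pi) ∧
        (∀ t ∈ Ioc 0 T₀,
            |discMass V σ t|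
              ≤ t * Real.sqrt t * Real.sqrt (T₀ / 3) * Real.sqrt (2 * w ^ 2 + discEnergy V σ T₀ / Real.pi)) := by
  intro γ c V σ T₀ w hT₀ hw hV hwall
  have hVc : Continuous V := hV.continuous
  have hπ : 0 < Real.pi := Real.pi_pos
  have h2π : (0 : ℝ) ≤ 2 * π := by positivity
  have hone : 1 / (2 * Real.pi) * (2 * Real.pi) = 1 := one_div_mul_cancel (by positivity)
  have hρ : 0 ≤ cylRadius c := cylRadius_nonneg c
  -- square-root bookkeeping: `X² ≤ M²·P·Q'` ⇒ `|X| ≤ M·√P·√Q'`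
  have sqrt3 : ∀ {X M P Q' : ℝ}, 0 ≤ M → 0 ≤ P → X ^ 2 ≤ M ^ 2 * P * Q' → |X| ≤ M * Real.sqrt P * Real.sqrt Q' :=
    fun {X M P Q'} hM hP h => by
      have h1 := Real.abs_le_sqrt h
      rwa [Real.sqrt_mul (by positivity), Real.sqrt_mul (sq_nonneg _), Real.sqrt_sq hM] at h1
  have sqrt2 : ∀ {X M P : ℝ}, 0 ≤ M → 0 ≤ P → X ^ 2 ≤ M ^ 2 * P → |X| ≤ M * Real.sqrt P :=
    fun {X M P} hM hP h => by
      have h1 := sqrt3 (Q' := 1) hM hP (by rw [mul_one]; exact h)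
      simpa only [Real.sqrt_one, mul_one] using h1
  have hD0 : 0 ≤ discEnergy V σ T₀ := by
    unfold discEnergy
    exact setIntegral_nonneg measurableSet_closedBall fun z _ => frobeniusNormSq_nonneg _
  -- the integrated wall bounds (cap Hardy + wall circle)
  have hIr := integral_circleAvg_r_sq_le_of_wall hV σ hT₀ hwall
  have hIz := integral_circleAvg_z_sq_le_of_wall hV σ hT₀ hwall
  have hIk := integral_circleAvg_shift_z_sq_le_of_wall hV σ (γ * (σ - c 2)) hT₀ hwall
  rw [abs_mul] at hIk
  -- `Q = 2w² + D/π`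
  obtain ⟨Q, hQ⟩ : ∃ Q : ℝ, Q = 2 * w ^ 2 + discEnergy V σ T₀ / Real.pi := ⟨_, rfl⟩
  have hQ0 : 0 ≤ Q := by rw [hQ]; positivity
  rw [← hQ] at hIr hIz ⊢
  -- joint continuity of the chart components
  have hA := (continuous_rayData hV σ).1
  have hZ := (continuous_rayData hV σ).2.2.1
  have ht1 : Continuous (uncurry fun t _ : ℝ => t) := continuous_fst
  -- the three square integrals
  have hG2 : ∫ t in (0 : ℝ)..T₀, ∫ θ in (0 : ℝ)..2 * π,
      ⟪V (axisPt σ t θ), rotZ θ (EuclideanSpace.single (0 : Fin 3) (1 : ℝ))⟫ ^ 2 ≤ 2 * Real.pi * (T₀ * Q) := by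
    rw [integral_integral_a_sq_eq V σ hT₀.le]; exact mul_le_mul_of_nonneg_left hIr h2π
  have hZ2 : ∀ {T : ℝ}, 0 ≤ T → T ≤ T₀ →
      ∫ t in (0 : ℝ)..T, ∫ θ in (0 : ℝ)..2 * π, axialVelocity V (axisPt σ t θ) ^ 2 ≤ 2 * Real.pi * (T₀ * Q) := by
    intro T hT hTT
    rw [integral_integral_z_sq_eq V σ T]
    refine mul_le_mul_of_nonneg_left (le_trans ?_ hIz) h2π
    have hzc : Continuous (axialVelocity V) := by
      unfold axialVelocity; exact (PiLp.continuous_apply 2 _ 2).comp hVc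
    refine intervalIntegral.integral_mono_interval le_rfl hT hTT ?_
      ((continuous_circleAvg_radius (hzc.fun_pow 2) σ).intervalIntegrable _ _)
    refine ae_of_all _ fun s => ?_
    unfold circleAvg
    exact mul_nonneg (by positivity) (intervalIntegral.integral_nonneg h2π fun θ _ => sq_nonneg _)
  have hF2 : ∫ t in (0 : ℝ)..T₀, ∫ θ in (0 : ℝ)..2 * π, (γ * (σ - c 2) + axialVelocity V (axisPt σ t θ)) ^ 2
      ≤ 2 * Real.pi * (T₀ * (2 * (|γ| * |σ - c 2| + w) ^ 2 + discEnergy V σ T₀ / Real.pi)) := by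
    rw [integral_integral_shift_z_sq_eq]; exact mul_le_mul_of_nonneg_left hIk h2π
  have hnn2 : ∀ (T : ℝ) (g : ℝ → ℝ → ℝ), 0 ≤ T → 0 ≤ ∫ t in (0 : ℝ)..T, ∫ θ in (0 : ℝ)..2 * π, g t θ ^ 2 := fun T g hT =>
    intervalIntegral.integral_nonneg hT fun t _ => intervalIntegral.integral_nonneg h2π fun θ _ => sq_nonneg _
  refine ⟨?_, ?_, ?_, ?_, ?_⟩
  · -- (1) end flux
    have h := endFluxHardy V σ T₀ hT₀ hV
    have hc := mul_le_mul_of_nonneg_left (circleAvg_rz_sq_le_of_wall (V := V) σ hT₀ hwall)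
      (by positivity : (0 : ℝ) ≤ 4 * Real.pi * T₀)
    linarith
  · -- (2) endTermC : Cauchy–Schwarz with `f = γ(σ − c₂) + V_z`, `g = ⟪V, R_θe₀⟫`
    have hf : Continuous (uncurry fun t θ : ℝ => γ * (σ - c 2) + axialVelocity V (axisPt σ t θ)) :=
      continuous_uncurry_const_add hZ _
    have hcs := sq_integral_integral_mul_le hf hA hT₀.le
    have hprod := mul_le_mul hF2 hG2 (hnn2 T₀ _ hT₀.le) (by positivity)
    have hX : endTermC γ c V T₀ σ = 1 / (2 * Real.pi) * ∫ t in (0 : ℝ)..T₀, ∫ θ in (0 : ℝ)..2 * π,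
        (γ * (σ - c 2) + axialVelocity V (axisPt σ t θ)) *
          ⟪V (axisPt σ t θ), rotZ θ (EuclideanSpace.single (0 : Fin 3) (1 : ℝ))⟫ := by
      rw [endTermC_eq_chart V γ c hT₀.le σ, intervalIntegral.integral_const_mul]
    refine sqrt3 hT₀.le (by positivity) ?_
    rw [hX, mul_pow]
    calc (1 / (2 * Real.pi)) ^ 2 * (∫ t in (0 : ℝ)..T₀, ∫ θ in (0 : ℝ)..2 * π,
            (γ * (σ - c 2) + axialVelocity V (axisPt σ t θ)) *
              ⟪V (axisPt σ t θ), rotZ θ (EuclideanSpace.single (0 : Fin 3) (1 : ℝ))⟫) ^ 2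
        ≤ (1 / (2 * Real.pi)) ^ 2 * (2 * Real.pi * (T₀ * (2 * (|γ| * |σ - c 2| + w) ^ 2 + discEnergy V σ T₀ / Real.pi))
            * (2 * Real.pi * (T₀ * Q))) := mul_le_mul_of_nonneg_left (hcs.trans hprod) (sq_nonneg _)
      _ = (1 / (2 * Real.pi) * (2 * Real.pi)) ^ 2 *
            (T₀ ^ 2 * (2 * (|γ| * |σ - c 2| + w) ^ 2 + discEnergy V σ T₀ / Real.pi) * Q) := by ring
      _ = T₀ ^ 2 * (2 * (|γ| * |σ - c 2| + w) ^ 2 + discEnergy V σ T₀ / Real.pi) * Q := by rw [hone]; ring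
  · -- (3) offsetTerm : Cauchy–Schwarz with `f = −(c₀cos θ + c₁sin θ)`, `g = V_z`
    have hm : Continuous fun θ : ℝ => -(c 0 * Real.cos θ + c 1 * Real.sin θ) := by fun_prop
    have hcs := sq_integral_integral_mul_le (continuous_uncurry_of_right hm) hZ hT₀.le
    have hρc : Continuous (uncurry fun _ _ : ℝ => cylRadius c ^ 2) := continuous_const
    have hM2 : ∫ t in (0 : ℝ)..T₀, ∫ θ in (0 : ℝ)..2 * π, (-(c 0 * Real.cos θ + c 1 * Real.sin θ)) ^ 2
        ≤ 2 * Real.pi * (T₀ * cylRadius c ^ 2) := by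
      have h := integral_integral_mono_continuous' (continuous_uncurry_sq (continuous_uncurry_of_right hm)) hρc hT₀.le
        fun t _ θ =>
          calc (-(c 0 * Real.cos θ + c 1 * Real.sin θ)) ^ 2 = |c 0 * Real.cos θ + c 1 * Real.sin θ| ^ 2 := by
                rw [neg_sq, sq_abs]
            _ ≤ cylRadius c ^ 2 := pow_le_pow_left₀ (abs_nonneg _) (abs_cos_sin_comb_le_cylRadius c θ) 2
      have e : ∫ t in (0 : ℝ)..T₀, ∫ θ in (0 : ℝ)..2 * π, cylRadius c ^ 2 = 2 * Real.pi * (T₀ * cylRadius c ^ 2) := by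
        simp only [intervalIntegral.integral_const, sub_zero, smul_eq_mul]
        ring
      rw [e] at h
      exact h
    have hprod := mul_le_mul hM2 (hZ2 hT₀.le le_rfl) (hnn2 T₀ _ hT₀.le) (by positivity)
    have hY : offsetTerm γ c V T₀ σ = γ * (1 / (2 * Real.pi) * ∫ t in (0 : ℝ)..T₀, ∫ θ in (0 : ℝ)..2 * π,
        (-(c 0 * Real.cos θ + c 1 * Real.sin θ)) * axialVelocity V (axisPt σ t θ)) := by
      rw [offsetTerm_eq_chart V γ c hT₀.le σ, intervalIntegral.integral_const_mul]
    refine sqrt2 (by positivity) hQ0 ?_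
    rw [hY, mul_pow, mul_pow]
    calc γ ^ 2 * ((1 / (2 * Real.pi)) ^ 2 * (∫ t in (0 : ℝ)..T₀, ∫ θ in (0 : ℝ)..2 * π,
            (-(c 0 * Real.cos θ + c 1 * Real.sin θ)) * axialVelocity V (axisPt σ t θ)) ^ 2)
        ≤ γ ^ 2 * ((1 / (2 * Real.pi)) ^ 2 * (2 * Real.pi * (T₀ * cylRadius c ^ 2) * (2 * Real.pi * (T₀ * Q)))) :=
          mul_le_mul_of_nonneg_left (mul_le_mul_of_nonneg_left (hcs.trans hprod) (sq_nonneg _)) (sq_nonneg γ)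
      _ = (1 / (2 * Real.pi) * (2 * Real.pi)) ^ 2 * (γ ^ 2 * cylRadius c ^ 2 * T₀ ^ 2 * Q) := by ring
      _ = (|γ| * cylRadius c * T₀) ^ 2 * Q := by rw [hone, mul_pow, mul_pow, sq_abs]; ring
  · -- (4) discMass at `T₀` : Cauchy–Schwarz with `f = t`, `g = V_z`
    have hcs := sq_integral_integral_mul_le ht1 hZ hT₀.le
    have hprod := mul_le_mul (le_of_eq (integral_integral_sq_radius T₀)) (hZ2 hT₀.le le_rfl) (hnn2 T₀ _ hT₀.le)
      (by positivity)
    refine sqrt2 (by positivity) hQ0 ?_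
    rw [discMass_eq_chart V σ T₀, mul_pow]
    calc (1 / (2 * Real.pi)) ^ 2 * (∫ t in (0 : ℝ)..T₀, ∫ θ in (0 : ℝ)..2 * π, t * axialVelocity V (axisPt σ t θ)) ^ 2
        ≤ (1 / (2 * Real.pi)) ^ 2 * (2 * Real.pi * T₀ ^ 3 / 3 * (2 * Real.pi * (T₀ * Q))) :=
          mul_le_mul_of_nonneg_left (hcs.trans hprod) (sq_nonneg _)
      _ = (1 / (2 * Real.pi) * (2 * Real.pi)) ^ 2 * (T₀ ^ 4 / 3 * Q) := by ring
      _ = (T₀ ^ 2 / Real.sqrt 3) ^ 2 * Q := by rw [hone, div_pow, Real.sq_sqrt (by norm_num : (0 : ℝ) ≤ 3)]; ring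
  · -- (5) discMass at `0 < t ≤ T₀`
    intro t ht
    have ht0 : 0 < t := ht.1
    have hcs := sq_integral_integral_mul_le ht1 hZ ht.1.le
    have hprod := mul_le_mul (le_of_eq (integral_integral_sq_radius t)) (hZ2 ht.1.le ht.2) (hnn2 t _ ht.1.le)
      (by positivity)
    refine sqrt3 (by positivity) (by positivity) ?_
    rw [discMass_eq_chart V σ t, mul_pow]
    calc (1 / (2 * Real.pi)) ^ 2 * (∫ s in (0 : ℝ)..t, ∫ θ in (0 : ℝ)..2 * π, s * axialVelocity V (axisPt σ s θ)) ^ 2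
        ≤ (1 / (2 * Real.pi)) ^ 2 * (2 * Real.pi * t ^ 3 / 3 * (2 * Real.pi * (T₀ * Q))) :=
          mul_le_mul_of_nonneg_left (hcs.trans hprod) (sq_nonneg _)
      _ = (1 / (2 * Real.pi) * (2 * Real.pi)) ^ 2 * (t ^ 3 * (T₀ / 3) * Q) := by ring
      _ = (t * Real.sqrt t) ^ 2 * (T₀ / 3) * Q := by rw [hone, mul_pow, Real.sq_sqrt ht.1.le]; ring

end Summit.NavierStokesRegularity.NavierStokesRegularity.Theorems.PowerGaugeEulerLiouville.HoopCore

end
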